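import Literature.MathematicalPhysics.QuantumFieldTheory.OSLabelledStep
import HarnessLib

/-!
# The tower of OS II's continuations with the Schwarz inequality between consecutive levels

Topic `Literature/MathematicalPhysics/QuantumFieldTheory`; support file (all proved; one auxiliary
`Prop`-valued predicate; no named facts) for the discharge of (A1) `OS1975_exists_timeContinuation`.
Sequel of `OSLabelledStep`. Osterwalder–Schrader II (Comm. Math. Phys. 42 (1975)), Ch. V.2 pp. 294–296
and Ch. VI.2 (6.22): the temperedness estimate (4.6) of Thm. 4.2 is proved in Ch. VI.2 by running the
induction of Ch. V.2 again *"carrying along the estimates"*, whose only analytic input at each step is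
the Schwarz inequality (6.22) `|S_k(ζ̄', x' + x + τ, ζ)| ≤ ‖e^{-τH}‖ ‖Ψₙ(x', ζ')‖ ‖Ψₘ(x, ζ)‖` with
`‖Ψₘ(x, ζ)‖² = S_{2m-1}(ζ̄, 2x, ζ)` — a relation between the function of level `N + 1` on the
generating pieces and the function of level `N` at the Gram points. The step of `OSLabelledStep`
constructs the new level through exactly this representation but does not export it; here it is
exported, and the whole tower is assembled into one family on `ℂ₊ᵏ` for which the Schwarz inequality
holds at **every** point (the pieces of all levels exhaust `ℂ₊ᵏ`):

* `IsSchwarzStep T good N S S'` — the Schwarz inequality between two consecutive levels, for every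
  split `x' + x + τ = Z_p` (`x', x > 0`, `Re τ ≥ 0`);
* `IsOSLabelledLevel.succ_schwarz` — the step of `OSLabelledStep` with the Schwarz inequality exported;
* `exists_mem_osBaseD`, `exists_mem_osPiece` — the regions `d_j^{(N)}` exhaust the cube and the pieces
  of position `p` exhaust `ℂ₊ᵏ` (Lemma 5.2);
* `IsOSLabelledLevel.exists_tower` — **the tower**: one family `Sext k c`, holomorphic on `ℂ₊ᵏ` for
  the good labels, extending the level-`N` data, with the explicit local bounds of
  `exists_continuation_halfPlanes_uniform`, and with the **level-free Schwarz inequality**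
  `‖Sext k c Z‖ ≤ ‖T τ‖ √(Re Sext_{2p+1}(GL)) √(Re Sext_{2q+1}(GR))` at every `Z ∈ ℂ₊ᵏ`, every position
  `p` and every split — the input of the temperedness induction of Ch. VI.2.

## References

* K. Osterwalder, R. Schrader, *Axioms for Euclidean Green's functions II*, Comm. Math. Phys. 42
  (1975) 281–305, Ch. V.2 pp. 294–296, Lemma 5.2; Ch. VI.2 (6.22)–(6.23), (6.28). [OsterwalderSchraderCMP1975]
-/

noncomputable section

open Metric Set Filter Complex
open scoped Topology ComplexConjugate InnerProductSpace Pointwise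

namespace Literature.MathematicalPhysics.QuantumFieldTheory.OSEnvelope

open Literature.Analysis.Complex Literature.MathematicalPhysics.QuantumFieldTheory

variable {E : Type*} {H : Type*} [NormedAddCommGroup H] [InnerProductSpace ℂ H]

/-! ### Exhaustion of the regions `d^{(N)}` and of the pieces -/

/-- **The regions `d_j^{(N)}` exhaust the cube** `(-π/2, π/2)ʲ` (Lemma 5.2 (a) with the rate of
`exists_osRho_ge`). [cite: OsterwalderSchraderCMP1975, Ch. V.2 Lemma 5.2 (a)] -/
theorem exists_mem_osBaseD {j : ℕ} (u : Fin j → ℝ) (hu : ∀ i, |u i| < Real.pi / 2) : ∃ N, u ∈ osBaseD N j := by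
  rcases Nat.eq_zero_or_pos j with rfl | hj
  · exact ⟨0, by rw [show u = 0 from funext fun i => i.elim0]; exact isOSBaseFamily_osBase.zero_mem_D 0 0⟩
  haveI : Nonempty (Fin j) := ⟨⟨0, hj⟩⟩
  obtain ⟨i₀, -, hi₀⟩ := Finset.exists_max_image Finset.univ (fun i => |u i|) Finset.univ_nonempty
  have hπ := Real.pi_pos
  set M : ℝ := |u i₀| with hM
  have hM0 : 0 ≤ M := abs_nonneg _
  have hMlt : M < Real.pi / 2 := hu i₀
  set θ : ℝ := (M + Real.pi / 2) / 2 with hθ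
  have hθ0 : 0 ≤ θ := by rw [hθ]; positivity
  have hθlt : θ < Real.pi / 2 := by rw [hθ]; linarith
  have hMθ : M < θ := by rw [hθ]; linarith
  have hθpos : 0 < θ := lt_of_le_of_lt hM0 hMθ
  set δ : ℝ := 1 - M / θ with hδ
  have hδ0 : 0 < δ := by
    rw [hδ, sub_pos, div_lt_one hθpos]; exact hMθ
  have hδ1 : δ ≤ 1 := by
    rw [hδ]; have : 0 ≤ M / θ := by positivity
    linarith
  have hMeq : θ * (1 - δ) = M := by rw [hδ]; field_simp; ring
  obtain ⟨A, -, hA⟩ := exists_osRho_ge j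
  obtain ⟨N, -, hρ⟩ := hA δ hδ0 hδ1
  refine ⟨N, isOSBaseFamily_osBase.mem_D_of_abs_le hθ0 hθlt u fun i => ?_⟩
  calc |u i| ≤ M := hi₀ i (Finset.mem_univ i)
    _ = θ * (1 - δ) := hMeq.symm
    _ ≤ osRho θ N (i + 1) := hρ θ hθ0 (i + 1) (by have := i.2; omega)

/-- **The pieces of position `p` exhaust `ℂ₊ᵏ`**: every argument vector of the cube lies in
`osPiece (N₀ + n + 1) k p` for some `n`. [cite: OsterwalderSchraderCMP1975, Ch. V.2 Lemma 5.2] -/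
theorem exists_mem_osPiece {k : ℕ} (p : Fin k) {v : Fin k → ℝ} (hv : ∀ i, |v i| < Real.pi / 2) (N₀ : ℕ) :
    ∃ n, v ∈ osPiece (N₀ + n + 1) k p := by
  obtain ⟨N₁, h₁⟩ := exists_mem_osBaseD (splitLeft v p) fun i => by
    rw [splitLeft_eq_neg_blockRevLeft]; simp only [Pi.neg_apply, abs_neg, blockRevLeft_apply]; exact hv _
  obtain ⟨N₂, h₂⟩ := exists_mem_osBaseD (splitRight v p) fun i => by
    rw [splitRight_eq_blockRight]; simp only [blockRight_apply]; exact hv _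
  refine ⟨N₁ + N₂, osBaseD_mono _ (show N₁ ≤ N₀ + (N₁ + N₂) + 1 by omega) h₁, hv p,
    osBaseD_mono _ (show N₂ ≤ N₀ + (N₁ + N₂) + 1 by omega) h₂⟩

/-! ### The Schwarz inequality between consecutive levels -/

/-- **The Schwarz inequality (6.22) between two consecutive levels**: on the argument region of each
piece of level `N + 1`, for every split `x' + x + τ = Z_p` (`x', x > 0`, `Re τ ≥ 0`),
`‖S' k c Z‖ ≤ ‖T τ‖ √(Re S_{2p+1}(dblPos left)(L, 2x', L̄)) √(Re S_{2q+1}(dblPos right)(R̄, 2x, R))`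
with `L = (Z_{p-1}, …, Z_0)`, `R = (Z_{p+1}, …)` (the squared norms (5.21) of the vectors of level
`N`). [cite: OsterwalderSchraderCMP1975, Ch. VI.2 (6.22)] -/
def IsSchwarzStep (T : ℂ → H →L[ℂ] H) (good : (k : ℕ) → (Fin (k + 1) → E) → Prop) (N : ℕ)
    (S S' : (k : ℕ) → (Fin (k + 1) → E) → (Fin k → ℂ) → ℂ) : Prop :=
  ∀ (k : ℕ) (c : Fin (k + 1) → E), good k c → ∀ (p : Fin k), ∀ Z ∈ argRegion (osPiece (N + 1) k p),
    ∀ (x' x : ℝ) (τ : ℂ), 0 < x' → 0 < x → 0 ≤ τ.re → (x' : ℂ) + x + τ = Z p →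
      ‖S' k c Z‖ ≤ ‖T τ‖ *
        Real.sqrt ((S (p + 1 + p) (dblPos (posRevLeft c p))
          (cDiagEmbed (blockRevLeft Z p) ((2 * x' : ℝ) : ℂ) (star (blockRevLeft Z p)))).re) *
        Real.sqrt ((S (k - 1 - p + 1 + (k - 1 - p)) (dblPos (posRight c p))
          (cDiagEmbed (star (blockRight Z p)) ((2 * x : ℝ) : ℂ) (blockRight Z p))).re)

/-! ### The step with the Schwarz inequality exported -/

section Step

variable [CompleteSpace H] {T : ℂ → H →L[ℂ] H} {CT : ℝ}
  {Φ : (n : ℕ) → (Fin (n + 1) → E) → ℝ → (Fin n → ℝ) → H}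
  {N : ℕ} {good : (k : ℕ) → (Fin (k + 1) → E) → Prop} {S : (k : ℕ) → (Fin (k + 1) → E) → (Fin k → ℂ) → ℂ}
  {Cfun : (k : ℕ) → Set (Fin k → ℝ) → ℝ} {pfun : ℕ → ℕ}

/-- **The labelled induction step with uniform constants and the Schwarz inequality exported**: as
`IsOSLabelledLevel.succ_uniform` (same construction), together with `IsSchwarzStep T good N S S'`. [cite: OsterwalderSchraderCMP1975, Ch. V.2 pp. 294–296; Ch. VI.2 (6.22), (6.28)] -/
theorem IsOSLabelledLevel.succ_schwarz (hT : IsOSSemigroup T CT) (hΦ : IsOSLabelledVectors T Φ)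
    (hgood : IsOSLabelSet good) (hL : IsOSLabelledLevel N good S Φ) (hG : IsOSLabelledGrowth N good S Cfun pfun) :
    ∃ S' : (k : ℕ) → (Fin (k + 1) → E) → (Fin k → ℂ) → ℂ,
      IsOSLabelledLevel (N + 1) good S' Φ ∧
      (∀ k c, EqOn (S' k c) (S k c) (argRegion (osBaseC (N + 1) k))) ∧
      IsOSLabelledGrowth (N + 1) good S' (succConst N CT Cfun pfun) (succExp pfun) ∧
      IsSchwarzStep T good N S S' := by
  classical
  -- (1) the vectors, for the labels with good doubled label
  obtain ⟨Ψ, hΨ⟩ := hL.exists_vectors hΦ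
  have hhol : ∀ (m : ℕ) (a : Fin (m + 1) → E), good (m + 1 + m) (dblPos a) → ∀ x : ℝ, 0 < x →
      DifferentiableOn ℂ (Ψ m a x) (argRegion (osBaseD (N + 1) m)) :=
    fun m a ha x hx => (hΨ m a ha x hx).1
  have hreal : ∀ (m : ℕ) (a : Fin (m + 1) → E), good (m + 1 + m) (dblPos a) → ∀ x : ℝ, 0 < x →
      ∀ η : Fin m → ℝ, (∀ i, 0 < η i) → Ψ m a x (fun i => (η i : ℂ)) = Φ m a x η :=
    fun m a ha x hx => (hΨ m a ha x hx).2.1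
  have hnorm : ∀ (m : ℕ) (a : Fin (m + 1) → E), good (m + 1 + m) (dblPos a) → ∀ x : ℝ, 0 < x →
      ∀ ζ ∈ argRegion (osBaseD (N + 1) m),
      ‖Ψ m a x ζ‖ ^ 2 = (S (m + 1 + m) (dblPos a) (cDiagEmbed (star ζ) ((2 * x : ℝ) : ℂ) ζ)).re :=
    fun m a ha x hx => (hΨ m a ha x hx).2.2.1
  have hshift : ∀ (m : ℕ) (a : Fin (m + 1) → E), good (m + 1 + m) (dblPos a) → ∀ x : ℝ, 0 < x →
      ∀ t : ℝ, 0 < t → ∀ ζ ∈ argRegion (osBaseD (N + 1) m), T t (Ψ m a x ζ) = Ψ m a (x + t) ζ :=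
    fun m a ha x hx => (hΨ m a ha x hx).2.2.2
  -- (2) the piece functions, for the good labels
  have hpieces : ∀ (k : ℕ) (c : Fin (k + 1) → E) (p : Fin k), good k c →
      ∃ F : (Fin k → ℂ) → ℂ, DifferentiableOn ℂ F (argRegion (osPiece (N + 1) k p)) ∧
      ∀ Z ∈ argRegion (osPiece (N + 1) k p), ∀ (x' x : ℝ) (τ : ℂ), 0 < x' → 0 < x → 0 ≤ τ.re →
        (x' : ℂ) + x + τ = Z p →
          F Z = ⟪Ψ p (posRevLeft c p) x' (star (blockRevLeft Z p)),
            T τ (Ψ (k - 1 - p) (posRight c p) x (blockRight Z p))⟫_ℂ :=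
    fun k c p hc => exists_pieceFunL hT (G := fun m a => good (m + 1 + m) (dblPos a)) hhol hshift k c p
      (hgood.left k c p hc) (hgood.right k c p hc)
  choose! F hFd hFsplit using hpieces
  have hFreal : ∀ (k : ℕ) (c : Fin (k + 1) → E) (p : Fin k), good k c → ∀ ρ : Fin k → ℝ, (∀ i, 0 < ρ i) →
      F k c p (fun i => (ρ i : ℂ)) = S k c (fun i => (ρ i : ℂ)) :=
    fun k c p hc ρ hρ => pieceFunL_ofReal hT hL (G := fun m a => good (m + 1 + m) (dblPos a)) hreal
      (hgood.left k c p hc) (hgood.right k c p hc) (hFsplit k c p hc) hρ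
  -- (3) glue, for every `k` and every good label
  have hglue : ∀ (k : ℕ) (c : Fin (k + 1) → E), good k c → ∃ G : (Fin k → ℂ) → ℂ,
      DifferentiableOn ℂ G (argRegion (stepBase N k)) ∧ EqOn G (S k c) (argRegion (osBaseC (N + 1) k)) ∧
      ∀ p, EqOn G (F k c p) (argRegion (osPiece (N + 1) k p)) :=
    fun k c hc => exists_glue (hL.holo k c hc) (fun p => hFd k c p hc) (fun p ρ hρ => hFreal k c p hc ρ hρ)
  choose! Gf hGd hGS hGF using hglue
  -- (4) the bound for the glued functions, with the explicit constant
  have hGgr : ∀ (k : ℕ) (c : Fin (k + 1) → E), good k c → ∀ K ⊆ stepBase N k, IsCompact K → ∀ Z ∈ argRegion K,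
      ‖Gf k c Z‖ ≤ glueConst N CT Cfun pfun k K * gFactor Z ^ stepExp pfun k :=
    fun k c hc K hK hKc Z hZ => norm_glue_leL hT hgood hG hnorm hc (hFsplit k c · hc) (hGS k c hc) (hGF k c hc)
      hKc hK hZ
  -- (5) extend, for every `k` and every label (trivially for the labels outside the class)
  have hext : ∀ (k : ℕ) (c : Fin (k + 1) → E), ∃ S' : (Fin k → ℂ) → ℂ,
      (good k c → DifferentiableOn ℂ S' (argRegion (osBaseC (N + 2) k))) ∧
      EqOn S' (S k c) (argRegion (osBaseC (N + 1) k)) ∧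
      (good k c → EqOn S' (Gf k c) (argRegion (stepBase N k))) := by
    intro k c
    by_cases hc : good k c
    · rcases Nat.eq_zero_or_pos k with rfl | hk
      · refine ⟨S 0 c, fun _ => ?_, fun _ _ => rfl, fun _ Z hZ => ?_⟩
        · rw [show N + 2 = (N + 1) + 1 from rfl, osBaseC_succ_zero, argRegion_empty]
          exact differentiableOn_empty
        · exfalso
          rcases hZ.2 with h | ⟨p, -⟩
          · rw [osBaseC_succ_zero] at h; exact h
          · exact p.elim0
      obtain ⟨fext, hfd, hfeq, -, -⟩ := exists_holomorphic_extension_argRegion_convexHull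
        (isOpen_stepBase N k) (zero_mem_stepBase N hk) (starConvex_stepBase N k) (stepBase_subset_cube N k)
        (hGd k c hc) ⟨stepExp pfun k, fun K hK hKc => ⟨glueConst N CT Cfun pfun k K,
          fun Z hZre hZK => hGgr k c hc K hK hKc Z ⟨hZre, hZK⟩⟩⟩
      rw [convexHull_stepBase] at hfd
      refine ⟨fext, fun _ => hfd, fun Z hZ => ?_, fun _ => hfeq⟩
      have hZ' : Z ∈ argRegion (stepBase N k) := argRegion_mono subset_union_left hZ
      rw [show fext Z = Gf k c Z from hfeq hZ', hGS k c hc hZ]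
    · exact ⟨S k c, fun h => absurd h hc, fun _ _ => rfl, fun h => absurd h hc⟩
  choose S' hS'd hS'eq hS'G using hext
  refine ⟨S', ⟨fun k c hc => hS'd k c hc, fun k c p ρ hρ x' x hx' hx hsum => ?_⟩, hS'eq,
    ⟨fun k c hc K hK hKc Z hZ => ?_⟩, fun k c hc p Z hZ x' x τ hx' hx hτ hsum => ?_⟩
  · have hmem : (fun i => (ρ i : ℂ)) ∈ argRegion (osBaseC (N + 1) k) :=
      ofReal_mem_argRegion (zero_mem_osBaseC _ (Fin.pos p)) hρ
    rw [hS'eq k c hmem]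
    exact hL.gram k c p ρ hρ x' x hx' hx hsum
  · -- (6) the uniform growth of the new level at `(k, c, K)`
    rcases Nat.eq_zero_or_pos k with rfl | hk
    · exfalso
      rw [show N + 2 = (N + 1) + 1 from rfl, osBaseC_succ_zero] at hK
      exact hK hZ.2
    rw [succConst, dif_pos ⟨hKc, hK, hk⟩]
    set ex := exists_lt_one_subset_smul (isOSBaseFamily_osBase.convex (N + 2) k)
      (isOpen_osBaseC_succ (N + 1) k) (zero_mem_osBaseC _ hk) hKc hK with hex
    set t₀ : ℝ := ex.choose with ht₀def
    obtain ⟨ht₀0, ht₀1, hKt⟩ := ex.choose_spec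
    -- the shrunken base
    set B' : Set (Fin k → ℝ) := t₀ • stepBase N k with hB'
    obtain ⟨hB'o, hB'0, hB'st, hB'conv⟩ := smul_stepBase_props N hk ht₀0
    have hB'K : B' ⊆ t₀ • closure (stepBase N k) := smul_set_mono subset_closure
    have hKcl : t₀ • closure (stepBase N k) ⊆ stepBase N k := smul_closure_stepBase_subset N hk ht₀0.le ht₀1
    have hB'cube : B' ⊆ {v | ∀ i, |v i| < Real.pi / 2} :=
      (hB'K.trans hKcl).trans (stepBase_subset_cube N k)
    -- `S' k c` on the region of `conv B' = t₀ · c^{(N+2)} ⊆ c^{(N+2)}`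
    have hconvsub : convexHull ℝ B' ⊆ osBaseC (N + 2) k := by
      rw [hB'conv]
      have h := smul_set_subset_smul_set_of_le (isOSBaseFamily_osBase.convex (N + 2) k)
        (zero_mem_osBaseC _ hk) ht₀0.le ht₀1.le
      rwa [one_smul] at h
    have hfB' : DifferentiableOn ℂ (S' k c) (argRegion (convexHull ℝ B')) :=
      (hS'd k c hc).mono (argRegion_mono hconvsub)
    -- the bound on the region of `B'`
    have hgrB' : ∀ ζ : Fin k → ℂ, (∀ i, 0 < (ζ i).re) → (fun i => (ζ i).arg) ∈ B' →
        ‖S' k c ζ‖ ≤ glueConst N CT Cfun pfun k (t₀ • closure (stepBase N k)) * gFactor ζ ^ stepExp pfun k := by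
      intro ζ hζ hζB'
      have hζst : ζ ∈ argRegion (stepBase N k) := ⟨hζ, hKcl (hB'K hζB')⟩
      rw [hS'G k c hc hζst]
      exact hGgr k c hc _ hKcl (isCompact_smul_closure_stepBase N k t₀) ζ ⟨hζ, hB'K hζB'⟩
    have hZconv : (fun i => (Z i).arg) ∈ convexHull ℝ B' := by rw [hB'conv]; exact hKt hZ.2
    have h := norm_le_explicit_of_polyGrowth_argRegion hB'o hB'0 hB'st hB'cube hfB' hgrB' hZ.1 hZconv
    simpa only [succExp, gFactor, mul_assoc] using h

  · -- (7) the Schwarz property on the pieces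
    have hZst : Z ∈ argRegion (stepBase N k) :=
      argRegion_mono ((osPiece_subset_osGen (N + 1) k p).trans subset_union_right) hZ
    rw [hS'G k c hc hZst, hGF k c hc p hZ, hFsplit k c p hc Z hZ x' x τ hx' hx hτ hsum]
    have hLmem : star (blockRevLeft Z p) ∈ argRegion (osBaseD (N + 1) p) :=
      star_blockRevLeft_mem_argRegion hZ.1 p hZ.2.1
    have hRmem : blockRight Z p ∈ argRegion (osBaseD (N + 1) (k - 1 - p)) :=
      blockRight_mem_argRegion hZ.1 p hZ.2.2.2
    have hnL : ‖Ψ p (posRevLeft c p) x' (star (blockRevLeft Z p))‖ =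
        Real.sqrt ((S (p + 1 + p) (dblPos (posRevLeft c p))
          (cDiagEmbed (blockRevLeft Z p) ((2 * x' : ℝ) : ℂ) (star (blockRevLeft Z p)))).re) := by
      have h2 := hnorm p _ (hgood.left k c p hc) x' hx' _ hLmem
      rw [star_star] at h2
      rw [← h2, Real.sqrt_sq (norm_nonneg _)]
    have hnR : ‖Ψ (k - 1 - p) (posRight c p) x (blockRight Z p)‖ =
        Real.sqrt ((S (k - 1 - p + 1 + (k - 1 - p)) (dblPos (posRight c p))
          (cDiagEmbed (star (blockRight Z p)) ((2 * x : ℝ) : ℂ) (blockRight Z p))).re) := by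
      have h2 := hnorm (k - 1 - p) _ (hgood.right k c p hc) x hx _ hRmem
      rw [← h2, Real.sqrt_sq (norm_nonneg _)]
    rw [← hnL, ← hnR]
    calc ‖⟪Ψ p (posRevLeft c p) x' (star (blockRevLeft Z p)),
          T τ (Ψ (k - 1 - p) (posRight c p) x (blockRight Z p))⟫_ℂ‖
        ≤ ‖Ψ p (posRevLeft c p) x' (star (blockRevLeft Z p))‖ *
            ‖T τ (Ψ (k - 1 - p) (posRight c p) x (blockRight Z p))‖ := norm_inner_le_norm _ _
      _ ≤ ‖Ψ p (posRevLeft c p) x' (star (blockRevLeft Z p))‖ *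
            (‖T τ‖ * ‖Ψ (k - 1 - p) (posRight c p) x (blockRight Z p)‖) :=
          mul_le_mul_of_nonneg_left ((T τ).le_opNorm _) (norm_nonneg _)
      _ = ‖T τ‖ * ‖Ψ p (posRevLeft c p) x' (star (blockRevLeft Z p))‖ *
            ‖Ψ (k - 1 - p) (posRight c p) x (blockRight Z p)‖ := by ring

end Step

/-! ### The tower -/

section Tower

variable [CompleteSpace H] {T : ℂ → H →L[ℂ] H} {CT : ℝ}
  {Φ : (n : ℕ) → (Fin (n + 1) → E) → ℝ → (Fin n → ℝ) → H}
  {N : ℕ} {good : (k : ℕ) → (Fin (k + 1) → E) → Prop} {S : (k : ℕ) → (Fin (k + 1) → E) → (Fin k → ℂ) → ℂ}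
  {Cfun : (k : ℕ) → Set (Fin k → ℝ) → ℝ} {pfun : ℕ → ℕ}

/-- The Gram point of the left block at a piece of level `M` lies in the region of
`c^{(M)}_{p+1+p}`. [folklore] -/
theorem gramLeft_mem_argRegion {M k : ℕ} {p : Fin k} {Z : Fin k → ℂ} (hZ : Z ∈ argRegion (osPiece M k p))
    {t : ℝ} (ht : 0 < t) :
    cDiagEmbed (blockRevLeft Z p) (t : ℂ) (star (blockRevLeft Z p)) ∈ argRegion (osBaseC M (p + 1 + p)) := by
  have hL := star_blockRevLeft_mem_argRegion (D := osBaseD M) hZ.1 p hZ.2.1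
  have h := cDiagEmbed_star_mem_argRegion hL.1 hL.2 ht
  rw [star_star] at h
  refine ⟨h.1, ?_⟩
  obtain ⟨u, hu, heq⟩ := h.2
  rw [← heq]
  exact (mem_osBaseD_iff u).1 hu

/-- The Gram point of the right block at a piece of level `M` lies in the region of
`c^{(M)}_{q+1+q}`. [folklore] -/
theorem gramRight_mem_argRegion {M k : ℕ} {p : Fin k} {Z : Fin k → ℂ} (hZ : Z ∈ argRegion (osPiece M k p))
    {t : ℝ} (ht : 0 < t) :
    cDiagEmbed (star (blockRight Z p)) (t : ℂ) (blockRight Z p) ∈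
      argRegion (osBaseC M (k - 1 - p + 1 + (k - 1 - p))) := by
  have hR := blockRight_mem_argRegion (D := osBaseD M) hZ.1 p hZ.2.2.2
  have h := cDiagEmbed_star_mem_argRegion hR.1 hR.2 ht
  refine ⟨h.1, ?_⟩
  obtain ⟨u, hu, heq⟩ := h.2
  rw [← heq]
  exact (mem_osBaseD_iff u).1 hu

/-- **The tower of continuations with the level-free Schwarz inequality** (OS II Ch. V.2 with (6.22)
at every level): from labelled level data at `N` with label-uniform growth, the semigroup hypotheses
and the labelled real-point vectors, one family `Sext k c` such that, for the good labels and `k ≥ 1`,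
`Sext k c` is holomorphic on `ℂ₊ᵏ`, equals `S k c` on the region of `c_k^{(N+1)}`, obeys the explicit
local bounds `cubeConst K · Π^{cubeExp K}`, and satisfies the Schwarz inequality
`‖Sext k c Z‖ ≤ ‖T τ‖ √(Re Sext_{2p+1}(dblPos left)(L, 2x', L̄)) √(Re Sext_{2q+1}(dblPos right)(R̄, 2x, R))`
at **every** `Z ∈ ℂ₊ᵏ`, every position `p` and every split `x' + x + τ = Z_p`. [cite: OsterwalderSchraderCMP1975, Ch. V.2 pp. 294–296, Lemma 5.2; Ch. VI.2 (6.22)] -/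
theorem IsOSLabelledLevel.exists_tower (hT : IsOSSemigroup T CT) (hΦ : IsOSLabelledVectors T Φ)
    (hgood : IsOSLabelSet good) (hL : IsOSLabelledLevel N good S Φ) (hG : IsOSLabelledGrowth N good S Cfun pfun) :
    ∃ Sext : (k : ℕ) → (Fin (k + 1) → E) → (Fin k → ℂ) → ℂ,
      (∀ (k : ℕ) (c : Fin (k + 1) → E), good k c → 0 < k →
        DifferentiableOn ℂ (Sext k c) {Z | ∀ i, 0 < (Z i).re}) ∧
      (∀ (k : ℕ) (c : Fin (k + 1) → E), EqOn (Sext k c) (S k c) (argRegion (osBaseC (N + 1) k))) ∧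
      (∀ (k : ℕ) (c : Fin (k + 1) → E), good k c → 0 < k →
        ∀ K : Set (Fin k → ℝ), IsCompact K → K ⊆ {v | ∀ i, |v i| < Real.pi / 2} →
          ∀ Z ∈ argRegion K, ‖Sext k c Z‖ ≤
            cubeConst N CT Cfun pfun k K * gFactor Z ^ cubeExp N CT Cfun pfun k K) ∧
      ∀ (k : ℕ) (c : Fin (k + 1) → E), good k c → ∀ (p : Fin k) (Z : Fin k → ℂ), (∀ i, 0 < (Z i).re) →
        ∀ (x' x : ℝ) (τ : ℂ), 0 < x' → 0 < x → 0 ≤ τ.re → (x' : ℂ) + x + τ = Z p →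
          ‖Sext k c Z‖ ≤ ‖T τ‖ *
            Real.sqrt ((Sext (p + 1 + p) (dblPos (posRevLeft c p))
              (cDiagEmbed (blockRevLeft Z p) ((2 * x' : ℝ) : ℂ) (star (blockRevLeft Z p)))).re) *
            Real.sqrt ((Sext (k - 1 - p + 1 + (k - 1 - p)) (dblPos (posRight c p))
              (cDiagEmbed (star (blockRight Z p)) ((2 * x : ℝ) : ℂ) (blockRight Z p))).re) := by
  classical
  -- (1) the sequence of levels with consecutive Schwarz inequalities
  let Pack : ℕ → Type _ := fun n =>
    {S₁ : (k : ℕ) → (Fin (k + 1) → E) → (Fin k → ℂ) → ℂ //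
      IsOSLabelledLevel (N + n) good S₁ Φ ∧
      IsOSLabelledGrowth (N + n) good S₁ (iterConst N CT Cfun pfun n).1 (iterConst N CT Cfun pfun n).2 ∧
      ∀ (k : ℕ) (c : Fin (k + 1) → E), EqOn (S₁ k c) (S k c) (argRegion (osBaseC (N + 1) k))}
  have hsucc : ∀ (n : ℕ) (P : Pack n), ∃ S₂ : (k : ℕ) → (Fin (k + 1) → E) → (Fin k → ℂ) → ℂ,
      (IsOSLabelledLevel (N + (n + 1)) good S₂ Φ ∧
        IsOSLabelledGrowth (N + (n + 1)) good S₂ (iterConst N CT Cfun pfun (n + 1)).1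
          (iterConst N CT Cfun pfun (n + 1)).2 ∧
        ∀ (k : ℕ) (c : Fin (k + 1) → E), EqOn (S₂ k c) (S k c) (argRegion (osBaseC (N + 1) k))) ∧
      IsSchwarzStep T good (N + n) P.1 S₂ := by
    intro n P
    obtain ⟨hL₁, hG₁, hEq₁⟩ := P.2
    obtain ⟨S₂, hL₂, hEq₂, hG₂, hS₂⟩ := hL₁.succ_schwarz hT hΦ hgood hG₁
    refine ⟨S₂, ⟨hL₂, hG₂, fun k c Z hZ => ?_⟩, hS₂⟩
    rcases Nat.eq_zero_or_pos k with rfl | hk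
    · rw [osBaseC_succ_zero, argRegion_empty] at hZ; exact absurd hZ (notMem_empty _)
    · have hZ' : Z ∈ argRegion (osBaseC (N + n + 1) k) :=
        argRegion_mono (osBaseC_mono hk (show N + 1 ≤ N + n + 1 by omega)) hZ
      rw [hEq₂ k c hZ', hEq₁ k c hZ]
  choose nxt hnxt hschw using hsucc
  let seq : (n : ℕ) → Pack n := fun n =>
    Nat.rec (motive := Pack) ⟨S, hL, hG, fun k c _ _ => rfl⟩ (fun n P => ⟨nxt n P, hnxt n P⟩) n
  set Sn : ℕ → (k : ℕ) → (Fin (k + 1) → E) → (Fin k → ℂ) → ℂ := fun n => (seq n).1 with hSn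
  have hSnS : ∀ n, Sn (n + 1) = nxt n (seq n) := fun n => rfl
  have hSnL : ∀ n, IsOSLabelledLevel (N + n) good (Sn n) Φ := fun n => (seq n).2.1
  have hSnG : ∀ n, IsOSLabelledGrowth (N + n) good (Sn n) (iterConst N CT Cfun pfun n).1
      (iterConst N CT Cfun pfun n).2 := fun n => (seq n).2.2.1
  have hSnEq : ∀ (n k : ℕ) (c : Fin (k + 1) → E), EqOn (Sn n k c) (S k c) (argRegion (osBaseC (N + 1) k)) :=
    fun n => (seq n).2.2.2
  have hSchw : ∀ n, IsSchwarzStep T good (N + n) (Sn n) (Sn (n + 1)) := fun n => by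
    rw [hSnS]; exact hschw n (seq n)
  -- (2) gluing per `(k, c)`
  have hglue : ∀ (k : ℕ) (c : Fin (k + 1) → E), good k c → 0 < k → ∃ Gk : (Fin k → ℂ) → ℂ,
      DifferentiableOn ℂ Gk {Z | ∀ i, 0 < (Z i).re} ∧
      ∀ n, EqOn Gk (Sn n k c) (argRegion (osBaseC (N + n + 1) k)) := by
    intro k c hc hk
    set U : ℕ → Set (Fin k → ℂ) := fun n => argRegion (osBaseC (N + n + 1) k) with hU
    have hUo : ∀ n, IsOpen (U n) := fun n => isOpen_argRegion (isOpen_osBaseC_succ _ _)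
    have hFd : ∀ n, DifferentiableOn ℂ (Sn n k c) (U n) := fun n => (hSnL n).holo k c hc
    have hagree : ∀ n m, EqOn (Sn n k c) (Sn m k c) (U n ∩ U m) := by
      intro n m
      simp only [hU]
      rw [← argRegion_inter]
      refine eqOn_argRegion_of_eqOn_posReal ((isOpen_osBaseC_succ _ _).inter (isOpen_osBaseC_succ _ _))
        ((isOSBaseFamily_osBase.convex _ _).inter (isOSBaseFamily_osBase.convex _ _))
        ⟨zero_mem_osBaseC _ hk, zero_mem_osBaseC _ hk⟩ (fun v hv => osBaseC_subset_cube _ _ hv.1)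
        ((hFd n).mono (argRegion_mono inter_subset_left))
        ((hFd m).mono (argRegion_mono inter_subset_right)) fun η hη => ?_
      have hmem : (fun i => (η i : ℂ)) ∈ argRegion (osBaseC (N + 1) k) :=
        ofReal_mem_argRegion (zero_mem_osBaseC _ hk) hη
      rw [hSnEq n k c hmem, hSnEq m k c hmem]
    obtain ⟨Gk, hGd, hGi⟩ := exists_differentiableOn_iUnion_of_eqOn_inter U (fun n => Sn n k c) hUo hFd hagree
    obtain ⟨k', rfl⟩ : ∃ k', k = k' + 1 := ⟨k - 1, by omega⟩
    have hcube : ⋃ n, osBaseC (N + n + 1) (k' + 1) = {v | ∀ i, |v i| < Real.pi / 2} := by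
      apply Subset.antisymm (iUnion_subset fun n => osBaseC_subset_cube _ _)
      rw [← iUnion_osBaseC k']
      refine iUnion_subset fun M => ?_
      exact (osBaseC_mono (Nat.succ_pos k') (show M ≤ N + M + 1 by omega)).trans
        (subset_iUnion (fun n => osBaseC (N + n + 1) (k' + 1)) M)
    have hUnion : (⋃ n, U n) = {Z : Fin (k' + 1) → ℂ | ∀ i, 0 < (Z i).re} := by
      simp only [hU]
      rw [← argRegion_iUnion, hcube]
      ext Z
      simp only [mem_argRegion, mem_setOf_eq, and_iff_left_iff_imp]
      intro hZ i
      exact Complex.abs_arg_lt_pi_div_two_iff.2 (Or.inl (hZ i))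
    exact ⟨Gk, by rw [← hUnion]; exact hGd, hGi⟩
  choose! Gk hGkd hGki using hglue
  -- (3) the family
  set Sext : (k : ℕ) → (Fin (k + 1) → E) → (Fin k → ℂ) → ℂ := fun k c =>
    if good k c ∧ 0 < k then Gk k c else S k c with hSext
  have hSext_good : ∀ (k : ℕ) (c : Fin (k + 1) → E), good k c → 0 < k → Sext k c = Gk k c := by
    intro k c hc hk; simp only [hSext, if_pos (And.intro hc hk)]
  refine ⟨Sext, fun k c hc hk => ?_, fun k c => ?_, fun k c hc hk K hKc hKcube Z hZ => ?_,
    fun k c hc p Z hZre x' x τ hx' hx hτ hsum => ?_⟩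
  · rw [hSext_good k c hc hk]; exact hGkd k c hc hk
  · by_cases h : good k c ∧ 0 < k
    · intro Z hZ
      rw [hSext_good k c h.1 h.2, hGki k c h.1 h.2 0 hZ]
      exact hSnEq 0 k c hZ
    · intro Z _; simp only [hSext, if_neg h]
  · set n := cubeLevel N k K with hn
    have hKn : K ⊆ osBaseC (N + n + 1) k := subset_osBaseC_cubeLevel hKc hKcube hk
    have hZU : Z ∈ argRegion (osBaseC (N + n + 1) k) := ⟨hZ.1, hKn hZ.2⟩
    rw [hSext_good k c hc hk, hGki k c hc hk n hZU]
    exact (hSnG n).bound k c hc K hKn hKc Z hZ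
  · -- (4) the level-free Schwarz inequality: `Z` lies in a piece of some level
    have hk : 0 < k := Fin.pos p
    obtain ⟨n, hn⟩ := exists_mem_osPiece p (v := fun i => (Z i).arg)
      (fun i => Complex.abs_arg_lt_pi_div_two_iff.2 (Or.inl (hZre i))) N
    have hZpiece : Z ∈ argRegion (osPiece (N + n + 1) k p) := ⟨hZre, hn⟩
    have hZU : Z ∈ argRegion (osBaseC (N + (n + 1) + 1) k) :=
      ⟨hZre, osPiece_subset_osBaseC_succ (N + n + 1) k p hn⟩
    have hl : good (p + 1 + p) (dblPos (posRevLeft c p)) := hgood.left k c p hc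
    have hr : good (k - 1 - p + 1 + (k - 1 - p)) (dblPos (posRight c p)) := hgood.right k c p hc
    have hGL := gramLeft_mem_argRegion hZpiece (by positivity : 0 < 2 * x')
    have hGR := gramRight_mem_argRegion hZpiece (by positivity : 0 < 2 * x)
    rw [hSext_good k c hc hk, hGki k c hc hk (n + 1) hZU,
      hSext_good _ _ hl (by omega), hGki _ _ hl (by omega) n hGL,
      hSext_good _ _ hr (by omega), hGki _ _ hr (by omega) n hGR]
    exact hSchw n k c hc p Z hZpiece x' x τ hx' hx hτ hsum

end Tower

end Literature.MathematicalPhysics.QuantumFieldTheory.OSEnvelope
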